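import Summits.AtomisticToContinuum.FouriersLaw.Theorems.OddSectorIrreversibilityCorrectorTheory

/-!
# The equilibrium conductance cap, part I: the contact identity at the right bath
(helpers `--supports` stmt-AtomisticToContinuum-9121 for stub `stub_totalGreenKuboCap` of line
`tap-duality-gk-time`, crux `BondHeatUncertainty.ExtensiveSnapshotIrreversibility`)

For the pinned anharmonic chain `P = pinnedChain ω₂ lam β γ` (`ω₂ > 0`, `lam, β ≥ 0`, `γ > 0`),
`T > 0`, `ρ = e^{-H/T}`, and a classical solution `u ∈ C² ∩ L²(μ_T)` of `L_{T,T} u = -k` with a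
continuous ODD source `k ∈ L²(μ_T)` (the Kubo corrector, `k = J`):

* `integral_mul_lastBondCurrent_mul_gibbsDensity` — **the contact identity at the right bath**:
  for the last site `m = N - 1` and the last bond `i = N - 2`,
  `∫ u j_i ρ dx = -γ T ∫ p_m ∂_{p_m} u ρ dx`. The site-`m` energy `h_m` has `X_H h_m = j_i - j_m = j_i`
  (`liouvilleOp_siteEnergy`, `j_{N-1} ≡ 0`); `X_H` is antisymmetric, `X_H u = -k - γ S u`,
  `⟨h_m, k⟩ = 0` by parity, and the Ornstein–Uhlenbeck tap at `m` sees `h_m` only through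
  `∂_{p_m} h_m = p_m` — the proof of `bond_sum_rule_density` run at the boundary site, with the
  energy cutoffs `χ_n` of the tree's Kubo calculus (`integral_chi_liouville_antisymm`,
  `integral_chi_mul_bathOp`) and dominated convergence;
* `sq_integral_mul_mul_gibbsDensity_le` — Cauchy–Schwarz against the Gibbs weight;
* `bondCurrent_eq_zero_of_succ_eq` (`j_{N-1} ≡ 0`), `sum_mul_add_eq_of_single` (bookkeeping).

Part II (`…TotalGreenKuboCap`) assembles the cap `0 ≤ ⟨u, J⟩_{μ_T} ≤ γ T² (N-1)²`.
References: Kundu–Dhar–Narayan 2009 (reln3); Bonetto–Lebowitz–Rey-Bellet 2000 §5.2; folklore.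
-/

noncomputable section

namespace Summit.AtomisticToContinuum.FouriersLaw.Theorems.ExtensiveSnapshotIrreversibility.TapDuality

open MeasureTheory Filter Topology
open scoped ENNReal NNReal ContDiff
open Literature.MathematicalPhysics.KineticTheory.HeatConduction
open Summit.AtomisticToContinuum.FouriersLaw.Theorems.OddSectorIrreversibility.Corrector
open Summit.AtomisticToContinuum.FouriersLaw.Theorems.SuperadditiveResistance.DeviceLiouville
open Summit.AtomisticToContinuum.FouriersLaw.Theorems.SuperadditiveResistance.Kubo
open Summit.AtomisticToContinuum.FouriersLaw.Theorems.SubdiffusiveBondHeat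

variable {N : ℕ}

/-- The last site carries no outgoing bond: `j_b ≡ 0` if `b + 1 = N`. [folklore] -/
theorem bondCurrent_eq_zero_of_succ_eq (P : OscillatorChain) (b : Fin N) (hb : b.val + 1 = N)
    (x : PhaseSpace N) : P.bondCurrent N b x = 0 := by
  unfold OscillatorChain.bondCurrent
  refine Finset.sum_eq_zero fun j _ => ?_
  have hj := j.isLt
  rw [if_neg (by omega)]

/-- Bookkeeping for the bath sum at the last site: if `B m = 1`, `X b = 0` off `m` and
`X m = X'`, then `∑_b B_b (X_b + Y_b) = X' + ∑_b B_b Y_b`. [folklore] -/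
theorem sum_mul_add_eq_of_single (B X Y : Fin N → ℝ) (m : Fin N) {X' : ℝ} (hBm : B m = 1)
    (hX : ∀ b, b ≠ m → X b = 0) (hXm : X m = X') :
    ∑ b, B b * (X b + Y b) = X' + ∑ b, B b * Y b := by
  have h1 : ∑ b, B b * (X b + Y b) = ∑ b, B b * X b + ∑ b, B b * Y b := by
    rw [← Finset.sum_add_distrib]
    exact Finset.sum_congr rfl fun b _ => mul_add _ _ _
  rw [h1, Finset.sum_eq_single_of_mem m (Finset.mem_univ _) fun b _ hb => by rw [hX b hb, mul_zero],
    hBm, one_mul, hXm]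

section Pinned

variable {ω₂ lam β γ : ℝ} (hω : 0 < ω₂) (hl : 0 ≤ lam) (hβ : 0 ≤ β) {T : ℝ} (hT : 0 < T)
include hω hl hβ hT

/-- Cauchy–Schwarz against the Gibbs weight: `(∫ f g ρ)² ≤ (∫ f² ρ)(∫ g² ρ)` for `f, g ∈ L²(μ_T)`
(the quadratic `t ↦ ∫ (t f + g)² ρ ≥ 0` has non-positive discriminant). [folklore] -/
theorem sq_integral_mul_mul_gibbsDensity_le (γ : ℝ) {f g : PhaseSpace N → ℝ}
    (hf : MemLp f 2 ((pinnedChain ω₂ lam β γ).gibbsMeasure N T))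
    (hg : MemLp g 2 ((pinnedChain ω₂ lam β γ).gibbsMeasure N T)) :
    (∫ x, f x * g x * (pinnedChain ω₂ lam β γ).gibbsDensity N T x) ^ 2 ≤
      (∫ x, f x ^ 2 * (pinnedChain ω₂ lam β γ).gibbsDensity N T x) *
        ∫ x, g x ^ 2 * (pinnedChain ω₂ lam β γ).gibbsDensity N T x := by
  set ρ := (pinnedChain ω₂ lam β γ).gibbsDensity N T with hρ
  have hρ0 : ∀ x, 0 ≤ ρ x := fun x => ((pinnedChain ω₂ lam β γ).gibbsDensity_pos N T x).le
  have iff' := integrable_sq_mul_gibbsDensity hω hl hβ γ N hT hf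
  have igg := integrable_sq_mul_gibbsDensity hω hl hβ γ N hT hg
  have ifg := integrable_mul_mul_gibbsDensity hω hl hβ γ N hT hf hg
  have hq : ∀ t : ℝ, 0 ≤ (∫ x, f x ^ 2 * ρ x) * (t * t) + (2 * ∫ x, f x * g x * ρ x) * t +
      ∫ x, g x ^ 2 * ρ x := by
    intro t
    have hnn : 0 ≤ ∫ x, (t * f x + g x) ^ 2 * ρ x :=
      integral_nonneg fun x => mul_nonneg (sq_nonneg _) (hρ0 x)
    have i1 : Integrable fun x => (t * t) * (f x ^ 2 * ρ x) := iff'.const_mul _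
    have i2 : Integrable fun x => (2 * t) * (f x * g x * ρ x) := ifg.const_mul _
    have e1 : ∫ x, (t * f x + g x) ^ 2 * ρ x =
        ∫ x, ((t * t) * (f x ^ 2 * ρ x) + (2 * t) * (f x * g x * ρ x)) + g x ^ 2 * ρ x :=
      integral_congr_ae (ae_of_all _ fun x => by ring)
    have i12 : Integrable fun x => (t * t) * (f x ^ 2 * ρ x) + (2 * t) * (f x * g x * ρ x) := i1.add i2
    rw [e1, integral_add i12 igg, integral_add i1 i2, integral_const_mul,
      integral_const_mul] at hnn
    linarith
  have hd := discrim_le_zero hq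
  rw [discrim] at hd
  nlinarith [hd]

variable (hγ : 0 < γ)
include hγ

/-- **Contact identity at the right bath (density form).** For `u ∈ C² ∩ L²(μ_T)`, a continuous
odd `k ∈ L²(μ_T)` with `L_{T,T} u = -k` pointwise, the last site `m` (`m + 1 = N`) and the last
bond `i` (`m = i + 1`): `∫ u j_i e^{-H/T} dx = -γ T ∫ p_m ∂_{p_m} u e^{-H/T} dx`. With the site
energy `h_m` (`X_H h_m = j_i - j_m = j_i`): `⟨u, X_H h_m⟩ = -⟨X_H u, h_m⟩ = ⟨k + γ S u, h_m⟩
= 0 + γ⟨u, S h_m⟩`-type computation at cutoff level `n` (`integral_chi_liouville_antisymm`,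
`integral_chi_mul_bathOp`), where the tap at `m` contributes `-T ∫ χ_n p_m ∂_{p_m} u ρ`, and
`n → ∞` by dominated convergence. [folklore] -/
theorem integral_mul_lastBondCurrent_mul_gibbsDensity {u k : PhaseSpace N → ℝ} (hu : ContDiff ℝ 2 u)
    (hu2 : MemLp u 2 ((pinnedChain ω₂ lam β γ).gibbsMeasure N T)) (hkc : Continuous k)
    (hk2 : MemLp k 2 ((pinnedChain ω₂ lam β γ).gibbsMeasure N T))
    (hkodd : ∀ x : PhaseSpace N, k (x.1, -x.2) = -k x)
    (hpde : ∀ x, (pinnedChain ω₂ lam β γ).generator N T T u x = -k x)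
    {i m : Fin N} (him : m.val = i.val + 1) (hmN : m.val + 1 = N) :
    ∫ x, u x * (pinnedChain ω₂ lam β γ).bondCurrent N i x * (pinnedChain ω₂ lam β γ).gibbsDensity N T x =
      -(γ * T) * ∫ x, x.2 m * partialP m u x * (pinnedChain ω₂ lam β γ).gibbsDensity N T x := by
  set P := pinnedChain ω₂ lam β γ with hP
  set ρ := P.gibbsDensity N T with hρ
  set B := OscillatorChain.bathWeight N with hB
  have hU : ContDiff ℝ ∞ P.U := pinnedChain_contDiff_U ω₂ lam β γ
  have hV : ContDiff ℝ ∞ P.V := pinnedChain_contDiff_V ω₂ lam β γ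
  have hUd : Differentiable ℝ P.U := hU.differentiable (by simp)
  have hVd : Differentiable ℝ P.V := hV.differentiable (by simp)
  have hU0 : ∀ q, 0 ≤ P.U q := fun q => by show 0 ≤ ω₂ * q ^ 2 / 2 + lam * q ^ 4 / 4; positivity
  have hV0 : ∀ r, 0 ≤ P.V r := fun r => by show 0 ≤ r ^ 2 / 2 + β * r ^ 4 / 4; positivity
  -- the site energy of the last site `m`
  set e : PhaseSpace N → ℝ := fun x => (∑ k : Fin N, (if k = m then (1 : ℝ) else 0) *
      (x.2 k ^ 2 / 2 + P.U (x.1 k))) + ∑ k : Fin N, ∑ l : Fin N,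
      if l.val = k.val + 1 then ((if k = m then (1 : ℝ) else 0) + (if l = m then (1 : ℝ) else 0)) / 2 *
        P.V (x.1 l - x.1 k) else 0 with he
  have hes : ContDiff ℝ ∞ e := by
    refine (ContDiff.sum fun k _ => contDiff_const.mul ((((contDiff_apply ℝ ℝ k).comp contDiff_snd).pow 2
      |>.div_const 2).add (hU.comp ((contDiff_apply ℝ ℝ k).comp contDiff_fst)))).add
      (ContDiff.sum fun k _ => ContDiff.sum fun l _ => ?_)
    split_ifs <;> first
      | exact contDiff_const.mul (hV.comp (((contDiff_apply ℝ ℝ l).comp contDiff_fst).sub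
          ((contDiff_apply ℝ ℝ k).comp contDiff_fst)))
      | exact contDiff_const
  have he2 : ContDiff ℝ 2 e := hes.of_le (by norm_cast)
  have hec : Continuous e := hes.continuous
  have hjm : ∀ x, P.bondCurrent N m x = 0 := fun x => bondCurrent_eq_zero_of_succ_eq P m hmN x
  have hLe : ∀ x, liouvilleOp P N e x = P.bondCurrent N i x := fun x => by
    rw [liouvilleOp_siteEnergy P m e he hUd hVd him x, hjm x, sub_zero]
  have hm0 : m.val ≠ 0 := by omega
  have hmN' : m.val = N - 1 := by omega
  have hBm : B m = 1 := by
    show ((if m.val = 0 then (1 : ℝ) else 0) + if m.val = N - 1 then (1 : ℝ) else 0) = 1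
    rw [if_neg hm0, if_pos hmN', zero_add]
  have hde : ∀ b : Fin N, b ≠ m → partialP b e = fun _ => 0 := fun b hb =>
    partialP_siteEnergy_of_ne P m e he hb
  have hdm : ∀ x, partialP m e x = x.2 m := fun x => by
    rw [partialP_siteEnergy P m e he m x, if_pos rfl, one_mul]
  -- parity and size of `e`
  have heven : ∀ x : PhaseSpace N, e (x.1, -x.2) = e x := fun x => siteEnergy_neg_momentum P m e he x
  have he0 : ∀ x, 0 ≤ e x := fun x => siteEnergy_nonneg P m e he hU0 hV0 x
  have heH : ∀ x, e x ≤ P.hamiltonian N x := fun x => siteEnergy_le_hamiltonian P m e he hU0 hV0 x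
  have hem2 : MemLp e 2 (P.gibbsMeasure N T) := memLp_two_of_le_hamiltonian hω hl hβ hT γ hec he0 heH
  -- the Poisson equation in operator form and the `L²` facts
  have hpde' : ∀ x, liouvilleOp P N u x = -k x - γ * bathOp N B T u x := fun x => by
    have := hpde x; rw [generator_eq_liouvilleOp_add] at this
    change liouvilleOp P N u x + γ * bathOp N B T u x = -k x at this; linarith
  have hu1 : ContDiff ℝ 1 u := hu.of_le (by norm_cast)
  have huc : Continuous u := hu.continuous
  have hduc : ∀ b, Continuous (partialP b u) := fun b => continuous_partialP hu1 one_ne_zero b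
  have hdu2 : ∀ {b : Fin N}, 0 < B b → MemLp (partialP b u) 2 (P.gibbsMeasure N T) := fun {b} hb =>
    memLp_partialP_of_poisson hω hl hβ hγ hT hu hu2 hk2 hpde hb
  have hdum : MemLp (partialP m u) 2 (P.gibbsMeasure N T) := hdu2 (by rw [hBm]; norm_num)
  have hpm2 : MemLp (fun x : PhaseSpace N => x.2 m) 2 (P.gibbsMeasure N T) :=
    memLp_of_integrable_sq_mul_gibbsDensity hω hl hβ γ N hT (by fun_prop)
      (pinnedChain_integrable_momentum_pow_mul_gibbsDensity hω hl hβ γ N hT m (k := 2) (by norm_num))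
  have hji : MemLp (fun x => P.bondCurrent N i x) 2 (P.gibbsMeasure N T) := memLp_bondCurrent hω hl hβ hT γ i
  -- cutoffs, density
  have hHs : ContDiff ℝ ∞ (P.hamiltonian N) := P.contDiff_hamiltonian hU hV N
  have hχc : ∀ n, Continuous (chi P N n) := fun n => (contDiff_chi hHs n).continuous
  have hχcs : ∀ n, HasCompactSupport (chi P N n) := fun n => hasCompactSupport_chi hω hl hβ γ N n
  have hρc : Continuous ρ := pinnedChain_continuous_gibbsDensity ω₂ lam β γ N T
  have hχbdd : ∀ n x, ‖chi P N n x‖ ≤ 1 := fun n x => by rw [Real.norm_eq_abs]; exact abs_chi_le_one n x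
  -- `L¹` facts
  have hujL1 : Integrable fun x => (u x * P.bondCurrent N i x) * ρ x :=
    integrable_mul_mul_gibbsDensity hω hl hβ γ N hT hu2 hji
  have hekL1 : Integrable fun x => (e x * k x) * ρ x := integrable_mul_mul_gibbsDensity hω hl hβ γ N hT hem2 hk2
  have hpdL1 : Integrable fun x => (x.2 m * partialP m u x) * ρ x :=
    integrable_mul_mul_gibbsDensity hω hl hβ γ N hT hpm2 hdum
  have hχuj : ∀ n, Integrable fun x => chi P N n x * (u x * P.bondCurrent N i x) * ρ x :=
    fun n => (hujL1.bdd_mul (hχc n).aestronglyMeasurable (Eventually.of_forall (hχbdd n))).congr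
      (Eventually.of_forall fun x => by ring)
  have hχek : ∀ n, Integrable fun x => chi P N n x * (e x * k x) * ρ x :=
    fun n => (hekL1.bdd_mul (hχc n).aestronglyMeasurable (Eventually.of_forall (hχbdd n))).congr
      (Eventually.of_forall fun x => by ring)
  -- the level-`n` identity
  have hlevel : ∀ n : ℕ, ∫ x, chi P N n x * (u x * P.bondCurrent N i x) * ρ x =
      (∫ x, chi P N n x * (e x * k x) * ρ x) -
        γ * T * (∫ x, chi P N n x * (x.2 m * partialP m u x) * ρ x) -
        γ * T * ∑ b, B b * ∫ x, e x * partialP b (chi P N n) x * partialP b u x * ρ x := by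
    intro n
    have hanti := integral_chi_liouville_antisymm hω hl hβ γ N hT.ne' hu he2 n
    have hbath := integral_chi_mul_bathOp hω hl hβ γ N B hT.ne' he2 hu n
    -- `∫ χ e (S u) ρ = -T (∫ χ p_m ∂_m u ρ + Σ_b B_b ∫ e ∂χ ∂u ρ)` (the `∂e` terms live at `m` only)
    have hbath' : ∫ x, chi P N n x * e x * bathOp N B T u x * ρ x =
        -T * ((∫ x, chi P N n x * (x.2 m * partialP m u x) * ρ x) +
          ∑ b, B b * ∫ x, e x * partialP b (chi P N n) x * partialP b u x * ρ x) := by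
      rw [hbath]
      congr 1
      refine sum_mul_add_eq_of_single B (fun b => ∫ x, chi P N n x * partialP b e x * partialP b u x * ρ x)
        (fun b => ∫ x, e x * partialP b (chi P N n) x * partialP b u x * ρ x) m hBm
        (fun b hb => by simp [hde b hb]) ?_
      exact integral_congr_ae (Eventually.of_forall fun x => by simp only [hdm x]; ring)
    -- pointwise: `χ(u X_H e + e X_H u) = χ u j_i - χ e k - γ χ e (S u)`
    have hpt : ∀ x, chi P N n x * (u x * liouvilleOp P N e x + e x * liouvilleOp P N u x) * ρ x =
        chi P N n x * (u x * P.bondCurrent N i x) * ρ x -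
          chi P N n x * (e x * k x) * ρ x - γ * (chi P N n x * e x * bathOp N B T u x * ρ x) := by
      intro x; rw [hLe, hpde']; ring
    have hI1 := hχuj n
    have hI2 := hχek n
    have hI3 : Integrable fun x => γ * (chi P N n x * e x * bathOp N B T u x * ρ x) :=
      ((((hχc n).mul hec).mul (continuous_bathOp hu B T)).mul hρc).integrable_of_hasCompactSupport
        (((hχcs n).mul_right).mul_right.mul_right) |>.const_mul γ
    have h0 : ∫ x, (chi P N n x * (u x * P.bondCurrent N i x) * ρ x -
        chi P N n x * (e x * k x) * ρ x - γ * (chi P N n x * e x * bathOp N B T u x * ρ x)) = 0 := by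
      rw [← hanti]; exact integral_congr_ae (Eventually.of_forall fun x => (hpt x).symm)
    have hI12 : Integrable fun x => chi P N n x * (u x * P.bondCurrent N i x) * ρ x -
        chi P N n x * (e x * k x) * ρ x := hI1.sub hI2
    rw [integral_sub hI12 hI3, integral_sub hI1 hI2, integral_const_mul, hbath'] at h0
    linarith
  -- the limits `n → ∞`
  have hlimL : Tendsto (fun n : ℕ => ∫ x, chi P N n x * (u x * P.bondCurrent N i x) * ρ x)
      atTop (𝓝 (∫ x, (u x * P.bondCurrent N i x) * ρ x)) :=
    tendsto_integral_chi_mul hω.le hl hβ γ N T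
      ((huc.mul (pinnedChain_continuous_bondCurrent ω₂ lam β γ N i)).aestronglyMeasurable) hujL1
  have hlim1 : Tendsto (fun n : ℕ => ∫ x, chi P N n x * (e x * k x) * ρ x) atTop (𝓝 (∫ x, (e x * k x) * ρ x)) :=
    tendsto_integral_chi_mul hω.le hl hβ γ N T ((hec.mul hkc).aestronglyMeasurable) hekL1
  have hek0 : ∫ x, (e x * k x) * ρ x = 0 :=
    integral_mul_gibbsDensity_eq_zero_of_odd P N T (g := fun x => e x * k x) fun x => by
      simp only [heven x, hkodd x]; ring
  have hlim3 : Tendsto (fun n : ℕ => ∫ x, chi P N n x * (x.2 m * partialP m u x) * ρ x) atTop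
      (𝓝 (∫ x, (x.2 m * partialP m u x) * ρ x)) :=
    tendsto_integral_chi_mul hω.le hl hβ γ N T
      ((((continuous_apply m).comp continuous_snd).mul (hduc m)).aestronglyMeasurable) hpdL1
  have hlim2 : ∀ b : Fin N, Tendsto (fun n : ℕ => B b * ∫ x, e x * partialP b (chi P N n) x * partialP b u x * ρ x)
      atTop (𝓝 (B b * 0)) := by
    intro b
    rcases (OddSectorIrreversibility.Corrector.bathWeight_nonneg N b).eq_or_lt with hb | hb
    · have hBb : B b = 0 := hb.symm
      simp only [hBb, zero_mul]
      exact tendsto_const_nhds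
    · refine Tendsto.const_mul _ ?_
      have hF : Integrable fun x => (e x * partialP b u x) * ρ x :=
        integrable_mul_mul_gibbsDensity hω hl hβ γ N hT hem2 (hdu2 hb)
      have h := tendsto_integral_partialP_chi_mul hω hl hβ γ N T b ((hec.mul (hduc b)).aestronglyMeasurable) hF
      have e1 : (fun n : ℕ => ∫ x, e x * partialP b (chi P N n) x * partialP b u x * ρ x) =
          fun n => ∫ x, partialP b (chi P N n) x * (e x * partialP b u x) * ρ x := by
        funext n; exact integral_congr_ae (Eventually.of_forall fun x => by ring)
      rw [e1]; exact h
  have hlimR : Tendsto (fun n : ℕ => (∫ x, chi P N n x * (e x * k x) * ρ x) -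
      γ * T * (∫ x, chi P N n x * (x.2 m * partialP m u x) * ρ x) -
      γ * T * ∑ b, B b * ∫ x, e x * partialP b (chi P N n) x * partialP b u x * ρ x) atTop
      (𝓝 ((∫ x, (e x * k x) * ρ x) - γ * T * (∫ x, (x.2 m * partialP m u x) * ρ x) -
        γ * T * ∑ b : Fin N, B b * 0)) :=
    (hlim1.sub (hlim3.const_mul _)).sub ((tendsto_finsetSum _ fun b _ => hlim2 b).const_mul _)
  have heq : ∫ x, (u x * P.bondCurrent N i x) * ρ x =
      (∫ x, (e x * k x) * ρ x) - γ * T * (∫ x, (x.2 m * partialP m u x) * ρ x) -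
        γ * T * ∑ b : Fin N, B b * 0 :=
    tendsto_nhds_unique (hlimL.congr fun n => hlevel n) hlimR
  rw [hek0] at heq
  simp only [mul_zero, Finset.sum_const_zero, sub_zero, zero_sub] at heq
  rw [heq]
  ring

end Pinned

/-- **Registered helper stub `helper_totalGreenKuboCapContact`** (closed form of
`integral_mul_lastBondCurrent_mul_gibbsDensity`, the contact identity at the right bath):
for the pinned chain, `u ∈ C² ∩ L²(μ_T)` solving `L_{T,T} u = -k` with a continuous odd source
`k ∈ L²(μ_T)`, the last site `m = i + 1`, `m + 1 = N`:
`∫ u j_i e^{-H/T} = -γ T ∫ p_m ∂_{p_m} u e^{-H/T}`. [folklore] -/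
theorem helper_totalGreenKuboCapContact :
    ∀ ω₂ lam β γ : ℝ, 0 < ω₂ → 0 ≤ lam → 0 ≤ β → 0 < γ → ∀ T : ℝ, 0 < T →
      ∀ (N : ℕ) (u k : PhaseSpace N → ℝ), ContDiff ℝ 2 u →
        MemLp u 2 ((pinnedChain ω₂ lam β γ).gibbsMeasure N T) → Continuous k →
        MemLp k 2 ((pinnedChain ω₂ lam β γ).gibbsMeasure N T) →
        (∀ x : PhaseSpace N, k (x.1, -x.2) = -k x) →
        (∀ x, (pinnedChain ω₂ lam β γ).generator N T T u x = -k x) →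
        ∀ (i m : Fin N), m.val = i.val + 1 → m.val + 1 = N →
          ∫ x, u x * (pinnedChain ω₂ lam β γ).bondCurrent N i x *
              (pinnedChain ω₂ lam β γ).gibbsDensity N T x =
            -(γ * T) * ∫ x, x.2 m * partialP m u x * (pinnedChain ω₂ lam β γ).gibbsDensity N T x :=
  fun _ _ _ _ hω hl hβ hγ _ hT _ _ _ hu hu2 hkc hk2 hkodd hpde _ _ him hmN =>
    integral_mul_lastBondCurrent_mul_gibbsDensity hω hl hβ hT hγ hu hu2 hkc hk2 hkodd hpde him hmN

end Summit.AtomisticToContinuum.FouriersLaw.Theorems.ExtensiveSnapshotIrreversibility.TapDuality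

end
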